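import Mathlib
import Literature.Probability.MarkovChains.MetropolisHastings
import Literature.Probability.MarkovChains.TotalVariation
import Summits.Ventures.LatticeQCDFlow.Exactness.JarzynskiFinite
import Summits.Ventures.LatticeQCDFlow.Scaling.SectorBudget

/-!
# LatticeQCDFlow / Scaling — stochastic normalizing flows / NE-MCMC as a path-space law:
# reversed kernels, Crooks' pathwise identity from stationarity, endpoint marginal (T2-S)

HONEST FRAMING: exact (Metropolis-corrected) sampling algorithms for lattice gauge theory;
figures of merit are autocorrelation/cost numbers at stated couplings and volumes; no
continuum-physics claim.

Venture `LatticeQCDFlow` (cell pub-lqcd), topic `Scaling`, THEORY-2.md §3.5 / §4 T2-S (v1.5),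
landed by FANOUT row 31 from `HOME/THEORY-2-Sketch.lean` v1.5 (theory seat), REBASED on row 30's
`Exactness/JarzynskiFinite.lean` vocabulary (`partitionFn`, `gibbsLaw`, `work`, `transProb`,
`pathLaw`, and its `jarzynski` / `jarzynski_reweighting` = E4/E4′, which are NOT re-proved here).
Finite configuration space `X`; a protocol of actions `S₀, …, S_n`; Markov layers `P_k` that
leave `e^{−S_{k+1}}` STATIONARY (heat bath, over-relaxation and their compositions — detailed
balance is NOT assumed anywhere below).

* `revKernel π P` — the `π`-reversal `P̂(y, x) = π(x) P(x, y)/π(y)`, row-stochastic from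
  stationarity alone (`revKernel_rowsum`); `revPathLaw S P` — the REVERSE path law (start from
  `e^{−S_n}/Z_n`, run the reversals backwards; Bonanno et al. arXiv:2510.25704 §2.1 `P_r`);
* `crooks_pathwise` (T2-S) — `P_F(ω) · e^{−W(ω)} = (Z_n/Z_0) · P_R(ω)` for EVERY path `ω`
  (Crooks 1998 assumes detailed balance; only stationarity is used);
* `sum_revChain_eq`, `sum_revPathLaw_mul`, `sum_revPathLaw`, `coarse_last_revPathLaw` — the
  reverse path law is a probability law whose ENDPOINT marginal is the final Gibbs law exactly.
The budgets that follow from this (path-space ESS = printed `⟨e^{−W}⟩²/⟨e^{−2W}⟩`, endpoint data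
processing, dissipation `D(P_F‖P_R) = ⟨W⟩ − ΔF ≥ 0`, perfect-relaxation law) are
`Scaling/StochasticBudgets.lean`.
-/

namespace Summit.Ventures.LatticeQCDFlow.Theory2

open Finset
open Literature.Probability.MarkovChains
open Summit.Ventures.LatticeQCDFlow.Exactness

variable {X : Type*} [Fintype X]

section PathSpace

variable {n : ℕ}

/-- The partition function of an action on a non-empty finite space is positive. [folklore] -/
theorem partitionFn_pos [Nonempty X] (S : X → ℝ) : 0 < partitionFn S :=
  sum_pos (fun _ _ => Real.exp_pos _) univ_nonempty

/-- The Gibbs law of an action on a non-empty finite space is positive. [folklore] -/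
theorem gibbsLaw_pos [Nonempty X] (S : X → ℝ) (x : X) : 0 < gibbsLaw S x :=
  div_pos (Real.exp_pos _) (partitionFn_pos S)

/-- The Gibbs law sums to one. [folklore] -/
theorem sum_gibbsLaw [Nonempty X] (S : X → ℝ) : ∑ x, gibbsLaw S x = 1 := by
  unfold gibbsLaw
  rw [← sum_div, div_eq_one_iff_eq (partitionFn_pos S).ne']
  rfl

/-- `π`-REVERSAL of a kernel, `P̂(y, x) = π(x) P(x, y) / π(y)`: row-stochastic as soon as `π` is
STATIONARY for `P` — detailed balance is not needed (the printed Crooks derivations assume it;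
the 1 heat-bath + 4 over-relaxation composite kernels of the SU(3) protocols are not reversible,
and stationarity is all that is used below). [folklore] -/
noncomputable def revKernel (π : X → ℝ) (P : X → X → ℝ) (y x : X) : ℝ := π x * P x y / π y

/-- REVERSE path law: `ω_n ∼ exp(−S_n)/Z_n`, then BACKWARDS in time with the
`exp(−S_{k+1})`-reversals of the forward kernels (arXiv:2510.25704 §2.1, `P_r`, there written for
reversible updates). -/
noncomputable def revPathLaw (S : Fin (n+1) → X → ℝ) (P : Fin n → X → X → ℝ)
    (ω : Fin (n+1) → X) : ℝ :=
  gibbsLaw (S (Fin.last n)) (ω (Fin.last n)) *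
    ∏ k : Fin n, revKernel (fun x => Real.exp (-(S k.succ x))) (P k) (ω k.succ) (ω k.castSucc)

/-- Reversed kernels have unit row sums as soon as `π` is stationary for `P`. [folklore] -/
theorem revKernel_rowsum {π : X → ℝ} {P : X → X → ℝ} (hπ : ∀ x, 0 < π x)
    (hst : IsStationary π P) (y : X) : ∑ x, revKernel π P y x = 1 := by
  unfold revKernel
  rw [← sum_div, hst y, div_self (hπ y).ne']

omit [Fintype X] in
/-- Reversal of a positive kernel w.r.t. a positive weight is positive. [folklore] -/
theorem revKernel_pos {π : X → ℝ} {P : X → X → ℝ} (hπ : ∀ x, 0 < π x)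
    (hP : ∀ x y, 0 < P x y) (y x : X) : 0 < revKernel π P y x :=
  div_pos (mul_pos (hπ x) (hP x y)) (hπ y)

omit [Fintype X] in
/-- Reversal of a non-negative kernel w.r.t. a positive weight is non-negative. [folklore] -/
theorem revKernel_nonneg {π : X → ℝ} {P : X → X → ℝ} (hπ : ∀ x, 0 < π x)
    (hP : ∀ x y, 0 ≤ P x y) (y x : X) : 0 ≤ revKernel π P y x :=
  div_nonneg (mul_nonneg (hπ x).le (hP x y)) (hπ y).le

omit [Fintype X] in
/-- Path laws of positive data are positive. [folklore] -/
theorem pathLaw_pos {μ : X → ℝ} (hμ : ∀ x, 0 < μ x) {P : Fin n → X → X → ℝ}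
    (hP : ∀ k x y, 0 < P k x y) (ω : Fin (n+1) → X) : 0 < pathLaw μ P ω :=
  mul_pos (hμ _) (prod_pos fun k _ => hP k _ _)

omit [Fintype X] in
/-- Path laws of non-negative data are non-negative. [folklore] -/
theorem pathLaw_nonneg {μ : X → ℝ} (hμ : ∀ x, 0 ≤ μ x) {P : Fin n → X → X → ℝ}
    (hP : ∀ k x y, 0 ≤ P k x y) (ω : Fin (n+1) → X) : 0 ≤ pathLaw μ P ω :=
  mul_nonneg (hμ _) (prod_nonneg fun k _ => hP k _ _)

/-- Reverse path laws of positive kernels are positive. [folklore] -/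
theorem revPathLaw_pos [Nonempty X] (S : Fin (n+1) → X → ℝ) {P : Fin n → X → X → ℝ}
    (hP : ∀ k x y, 0 < P k x y) (ω : Fin (n+1) → X) : 0 < revPathLaw S P ω :=
  mul_pos (gibbsLaw_pos (S _) _) (prod_pos fun k _ => revKernel_pos (fun _ => Real.exp_pos _) (hP k) _ _)

/-- Reverse path laws of non-negative kernels are non-negative. [folklore] -/
theorem revPathLaw_nonneg [Nonempty X] (S : Fin (n+1) → X → ℝ) {P : Fin n → X → X → ℝ}
    (hP : ∀ k x y, 0 ≤ P k x y) (ω : Fin (n+1) → X) : 0 ≤ revPathLaw S P ω :=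
  mul_nonneg (gibbsLaw_pos (S _) _).le
    (prod_nonneg fun k _ => revKernel_nonneg (fun _ => Real.exp_pos _) (hP k) _ _)

/-- The field identity behind Crooks' theorem (all Boltzmann weights non-zero). -/
theorem crooks_algebra {e0 el Z0 Zn A B C D : ℝ} (hC : C ≠ 0) (hD : D ≠ 0) (hZ0 : Z0 ≠ 0)
    (hZn : Zn ≠ 0) (htel : e0 * D = C * el) :
    e0 / Z0 * A * (B / C) = Zn / Z0 * (el / Zn * (B * A / D)) := by
  have hel : el = e0 * D / C := by
    rw [eq_div_iff hC]
    linarith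
  subst hel
  field_simp

/-- **T2-S (Crooks' pathwise fluctuation identity from stationarity; proved).**
`P_F(ω) · e^{−W(ω)} = (Z_n/Z_0) · P_R(ω)` for EVERY path, where `P_R` is built from the
`exp(−S_{k+1})`-reversals of the forward kernels.  Crooks 1998 / arXiv:2510.25704 eq. (Crooks)
assume detailed balance; here only `Σ_x e^{−S_{k+1}(x)} P_k(x,y) = e^{−S_{k+1}(y)}` is used, and
not even row-stochasticity. [folklore] -/
theorem crooks_pathwise [Nonempty X] (S : Fin (n+1) → X → ℝ) (P : Fin n → X → X → ℝ)
    (ω : Fin (n+1) → X) :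
    pathLaw (gibbsLaw (S 0)) P ω * Real.exp (-(work S ω)) =
      partitionFn (S (Fin.last n)) / partitionFn (S 0) * revPathLaw S P ω := by
  have hZ0 : partitionFn (S 0) ≠ 0 := (partitionFn_pos (S 0)).ne'
  have hZn : partitionFn (S (Fin.last n)) ≠ 0 := (partitionFn_pos (S _)).ne'
  have htel : Real.exp (-(S 0 (ω 0))) * ∏ k : Fin n, Real.exp (-(S k.succ (ω k.succ))) =
      (∏ k : Fin n, Real.exp (-(S k.castSucc (ω k.castSucc)))) *
        Real.exp (-(S (Fin.last n) (ω (Fin.last n)))) :=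
    (Fin.prod_univ_succ fun i : Fin (n+1) => Real.exp (-(S i (ω i)))).symm.trans
      (Fin.prod_univ_castSucc fun i : Fin (n+1) => Real.exp (-(S i (ω i))))
  have hC : (∏ k : Fin n, Real.exp (-(S k.castSucc (ω k.castSucc)))) ≠ 0 :=
    prod_ne_zero_iff.mpr fun k _ => (Real.exp_pos _).ne'
  have hD : (∏ k : Fin n, Real.exp (-(S k.succ (ω k.succ)))) ≠ 0 :=
    prod_ne_zero_iff.mpr fun k _ => (Real.exp_pos _).ne'
  have hw : Real.exp (-(work S ω)) = (∏ k : Fin n, Real.exp (-(S k.succ (ω k.castSucc)))) /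
      ∏ k : Fin n, Real.exp (-(S k.castSucc (ω k.castSucc))) := by
    rw [← prod_div_distrib, work, ← sum_neg_distrib, Real.exp_sum]
    refine prod_congr rfl fun k _ => ?_
    rw [← Real.exp_sub]
    congr 1
    ring
  simp only [pathLaw, transProb, revPathLaw, gibbsLaw, revKernel]
  rw [hw, prod_div_distrib, prod_mul_distrib]
  exact crooks_algebra hC hD hZ0 hZn (by rw [htel, mul_comm])

/-! ### Marginalisation over path space -/

omit [Fintype X] in
/-- `Fin.cons` bookkeeping. [folklore] -/
theorem cons_last' (x₀ : X) (ω' : Fin (n+1) → X) :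
    (Fin.cons x₀ ω' : Fin (n+2) → X) (Fin.last (n+1)) = ω' (Fin.last n) := rfl

omit [Fintype X] in
/-- `Fin.cons` bookkeeping. [folklore] -/
theorem cons_succ_castSucc' (x₀ : X) (ω' : Fin (n+1) → X) (j : Fin n) :
    (Fin.cons x₀ ω' : Fin (n+2) → X) j.succ.castSucc = ω' j.castSucc := rfl

omit [Fintype X] in
/-- `Fin.cons` bookkeeping. [folklore] -/
theorem cons_castSucc_zero' (x₀ : X) (ω' : Fin (n+1) → X) :
    (Fin.cons x₀ ω' : Fin (n+2) → X) (0 : Fin (n+1)).castSucc = x₀ := rfl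

omit [Fintype X] in
/-- `Fin.snoc` bookkeeping. [folklore] -/
theorem snoc_castSucc_castSucc' (ω' : Fin (n+1) → X) (x : X) (j : Fin n) :
    (Fin.snoc ω' x : Fin (n+2) → X) j.castSucc.castSucc = ω' j.castSucc :=
  Fin.snoc_castSucc ..

omit [Fintype X] in
/-- `Fin.snoc` bookkeeping. [folklore] -/
theorem snoc_castSucc_succ' (ω' : Fin (n+1) → X) (x : X) (j : Fin n) :
    (Fin.snoc ω' x : Fin (n+2) → X) j.castSucc.succ = ω' j.succ := by
  show (Fin.snoc ω' x : Fin (n+2) → X) j.succ.castSucc = ω' j.succ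
  exact Fin.snoc_castSucc ..

omit [Fintype X] in
/-- `Fin.snoc` bookkeeping. [folklore] -/
theorem snoc_zero' (ω' : Fin (n+1) → X) (x : X) :
    (Fin.snoc ω' x : Fin (n+2) → X) 0 = ω' 0 := by
  show (Fin.snoc ω' x : Fin (n+2) → X) (0 : Fin (n+1)).castSucc = ω' 0
  exact Fin.snoc_castSucc ..

omit [Fintype X] in
/-- `Fin.snoc` bookkeeping. [folklore] -/
theorem snoc_last_castSucc' (ω' : Fin (n+1) → X) (x : X) :
    (Fin.snoc ω' x : Fin (n+2) → X) (Fin.last n).castSucc = ω' (Fin.last n) :=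
  Fin.snoc_castSucc ..

omit [Fintype X] in
/-- `Fin.snoc` bookkeeping. [folklore] -/
theorem snoc_last_succ' (ω' : Fin (n+1) → X) (x : X) :
    (Fin.snoc ω' x : Fin (n+2) → X) (Fin.last n).succ = x := by
  show (Fin.snoc ω' x : Fin (n+2) → X) (Fin.last (n+1)) = x
  exact Fin.snoc_last ..

/-- Backward chains with unit row sums leave the starting (= final-time) law alone:
`Σ_ω f(ω_n) Π_k R_k(ω_{k+1}, ω_k) = Σ_x f x`.  (Sum out `ω₀`, then `ω₁`, ….) -/
theorem sum_revChain_eq : ∀ (n : ℕ) (R : Fin n → X → X → ℝ), (∀ k y, ∑ x, R k y x = 1) →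
    ∀ f : X → ℝ, ∑ ω : Fin (n+1) → X, f (ω (Fin.last n)) *
      ∏ k : Fin n, R k (ω k.succ) (ω k.castSucc) = ∑ x, f x
  | 0, R, _, f => by
      simp only [Fin.prod_univ_zero, mul_one]
      exact Fintype.sum_equiv (Equiv.funUnique (Fin 1) X) _ _ (fun ω => rfl)
  | n+1, R, hR, f => by
      rw [← (Fin.consEquiv fun _ : Fin (n+2) => X).sum_comp, Fintype.sum_prod_type, sum_comm]
      simp only [Fin.consEquiv_apply, Fin.prod_univ_succ, Fin.cons_succ, cons_last',
        cons_succ_castSucc', cons_castSucc_zero']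
      rw [← sum_revChain_eq n (fun k => R k.succ) (fun k y => hR k.succ y) f]
      refine sum_congr rfl fun ω' _ => ?_
      rw [← mul_sum, ← sum_mul, hR 0, one_mul]

/-- Endpoint expectation under the REVERSE path law = expectation under the final Gibbs law
(stationarity of `exp(−S_{k+1})` under `P_k` for every `k`; no reversibility). -/
theorem sum_revPathLaw_mul [Nonempty X] (S : Fin (n+1) → X → ℝ) (P : Fin n → X → X → ℝ)
    (hst : ∀ k : Fin n, IsStationary (fun x => Real.exp (-(S k.succ x))) (P k)) (f : X → ℝ) :
    ∑ ω, revPathLaw S P ω * f (ω (Fin.last n)) = ∑ x, gibbsLaw (S (Fin.last n)) x * f x := by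
  have h := sum_revChain_eq n (fun k => revKernel (fun x => Real.exp (-(S k.succ x))) (P k))
    (fun k y => revKernel_rowsum (fun _ => Real.exp_pos _) (hst k) y)
    (fun x => gibbsLaw (S (Fin.last n)) x * f x)
  refine Eq.trans (sum_congr rfl fun ω _ => ?_) h
  simp only [revPathLaw]
  ring

/-- The reverse path law is a probability law (stationarity only). [folklore] -/
theorem sum_revPathLaw [Nonempty X] (S : Fin (n+1) → X → ℝ) (P : Fin n → X → X → ℝ)
    (hst : ∀ k : Fin n, IsStationary (fun x => Real.exp (-(S k.succ x))) (P k)) :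
    ∑ ω, revPathLaw S P ω = 1 := by
  have h := sum_revPathLaw_mul S P hst (fun _ => 1)
  simp only [mul_one] at h
  rw [h, sum_gibbsLaw]

/-- The ENDPOINT marginal of the reverse path law is the final Gibbs law. -/
theorem coarse_last_revPathLaw [Nonempty X] [DecidableEq X] (S : Fin (n+1) → X → ℝ)
    (P : Fin n → X → X → ℝ)
    (hst : ∀ k : Fin n, IsStationary (fun x => Real.exp (-(S k.succ x))) (P k)) :
    coarse (fun ω : Fin (n+1) → X => ω (Fin.last n)) (revPathLaw S P) = gibbsLaw (S (Fin.last n)) := by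
  funext y
  have h := sum_revPathLaw_mul S P hst (fun x => if x = y then 1 else 0)
  simp only [mul_ite, mul_one, mul_zero, sum_ite_eq', mem_univ, ite_true] at h
  rw [← h]
  simp only [coarse, sum_filter]

end PathSpace

end Summit.Ventures.LatticeQCDFlow.Theory2
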